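import Summits.CriticalPhenomena.PercolationContinuityZ3.Theorems.PercNearOneGluingNoHeavyLowerTailThreePointCPIAdjacentPort
import HarnessLib

/-!
# 3-point CPI₂ reduced to contraction (or deletion) monotonicity of the port

Crux `stmt-CriticalPhenomena-4575`, route `PercNearOneGluingNoHeavy`, fibre line (facecert memo gen 24b
§0(1)–(2)).  For a finite multigraph `(V, α, ends)` with terminals `s, b` and port `c` write
`M = #{z : s ↮ b, c ↔ {s,b} in z}`, `L = #{z : s ↮ b in z, c ↔ {s,b} in z̄}` and `N = 2M − L`
(3-point CPI₂ is `N ≥ 0`, i.e. `L ≤ 2M`).  Contracting a port edge: for a label `a₀` with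
`ends a₀ = s(c, v)`, `v ∉ {s, b, c}`, the contracted multigraph `G/a₀` keeps the labels `a ≠ a₀` and
replaces the endpoint `v` by `c` (parallel copies of `a₀` become loops, `v` becomes isolated).

**Contraction monotonicity** (memo gen 24b, conjecture cMONO₃, 0 violations in ≈ 1.8·10⁶ exact tests)
says `N(G) ≥ N(G/a₀)` for every such internal port edge.  This file proves, unconditionally, the
REDUCTION: if contraction monotonicity holds for all finite multigraphs on the vertex type `V`, then
3-point CPI₂ holds for all of them (`threePoint_cpi_two_of_contraction_monotone`); the same for
deletion monotonicity `N(G) ≥ N(G − a₀)` (conjecture dMONO₃, 0 violations in ≈ 2.8·10⁶ tests;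
`threePoint_cpi_two_of_deletion_monotone`).  The induction is on
the number of labels: either some label joins `c` to a terminal (then CPI₂ is the theorem
`threePoint_cpi_two_of_port_adj` of `…ThreePointCPIAdjacentPort`), or some label joins `c` to an internal
vertex (contract it: the hypothesis plus the induction hypothesis), or every label at `c` is a loop
(then `c` reaches nothing and `L = 0`).  No definitions; the hypothesis is spelled out in the
vocabulary of `Literature/Probability/Percolation/ComplementPatternCounts.lean`.
-/

namespace Summit.CriticalPhenomena.PercolationContinuityZ3.Theorems.ThreePointCPIContraction

open Finset Literature.Probability.Percolation ThreePointCPIAdjacentPort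

universe u w

variable {V : Type u}

/-- If every label at `c` is a loop, `c` reaches only itself in every open graph. [folklore] -/
theorem eq_of_reachable_of_loops {α : Type w} (ends : α → Sym2 V) (c : V)
    (hloop : ∀ a, c ∈ ends a → (ends a).IsDiag) (z : α → Bool) {x : V}
    (h : (openGraph (labelledOpen ends z)).Reachable c x) : x = c := by
  obtain ⟨p⟩ := h
  cases p with
  | nil => rfl
  | cons hadj p' =>
    exfalso
    rw [openGraph_adj] at hadj
    obtain ⟨⟨a, -, hae⟩, hne⟩ := hadj
    have hca : c ∈ ends a := by rw [hae]; exact Sym2.mem_mk_left _ _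
    have hd := hloop a hca
    rw [hae, Sym2.mk_isDiag_iff] at hd
    exact hne hd

open Classical in
/-- **3-point CPI₂ from contraction monotonicity.**  Assume that for every finite multigraph on `V`,
every choice of terminals `s, b`, port `c` and every label `a₀` joining `c` to a vertex
`v ∉ {s, b, c}`, contracting `a₀` does not increase `N = 2M − L`
(hypothesis `hmono`, written as `2·M(G/a₀) + L(G) ≤ 2·M(G) + L(G/a₀)`).  Then `L ≤ 2M` for every
finite multigraph on `V` with `c ∉ {s, b}`. [facecert gen 24b §0(1)] -/
theorem threePoint_cpi_two_of_contraction_monotone [DecidableEq V]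
    (hmono : ∀ {α : Type w} [Fintype α] [DecidableEq α] (ends : α → Sym2 V) (s b c v : V)
      (a₀ : α), ends a₀ = s(c, v) → v ≠ s → v ≠ b → v ≠ c →
      2 * (univ.filter fun z : {a // a ≠ a₀} → Bool =>
          ¬ (openGraph (labelledOpen (fun a : {a // a ≠ a₀} =>
              (ends a.1).map fun x => if x = v then c else x) z)).Reachable s b ∧
          ((openGraph (labelledOpen (fun a : {a // a ≠ a₀} =>
              (ends a.1).map fun x => if x = v then c else x) z)).Reachable c s ∨
            (openGraph (labelledOpen (fun a : {a // a ≠ a₀} =>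
              (ends a.1).map fun x => if x = v then c else x) z)).Reachable c b)).card +
        (univ.filter fun z : α → Bool =>
          ¬ (openGraph (labelledOpen ends z)).Reachable s b ∧
          ((openGraph (labelledOpen ends fun a => !z a)).Reachable c s ∨
            (openGraph (labelledOpen ends fun a => !z a)).Reachable c b)).card ≤
      2 * (univ.filter fun z : α → Bool =>
          ¬ (openGraph (labelledOpen ends z)).Reachable s b ∧
          ((openGraph (labelledOpen ends z)).Reachable c s ∨
            (openGraph (labelledOpen ends z)).Reachable c b)).card +
        (univ.filter fun z : {a // a ≠ a₀} → Bool =>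
          ¬ (openGraph (labelledOpen (fun a : {a // a ≠ a₀} =>
              (ends a.1).map fun x => if x = v then c else x) z)).Reachable s b ∧
          ((openGraph (labelledOpen (fun a : {a // a ≠ a₀} =>
              (ends a.1).map fun x => if x = v then c else x) fun a => !z a)).Reachable c s ∨
            (openGraph (labelledOpen (fun a : {a // a ≠ a₀} =>
              (ends a.1).map fun x => if x = v then c else x) fun a => !z a)).Reachable c b)).card)
    {α : Type w} [Fintype α] [DecidableEq α] (ends : α → Sym2 V) (s b c : V)
    (hcs : c ≠ s) (hcb : c ≠ b) :
    (univ.filter fun z : α → Bool =>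
        ¬ (openGraph (labelledOpen ends z)).Reachable s b ∧
        ((openGraph (labelledOpen ends fun a => !z a)).Reachable c s ∨
          (openGraph (labelledOpen ends fun a => !z a)).Reachable c b)).card ≤
      2 * (univ.filter fun z : α → Bool =>
        ¬ (openGraph (labelledOpen ends z)).Reachable s b ∧
        ((openGraph (labelledOpen ends z)).Reachable c s ∨
          (openGraph (labelledOpen ends z)).Reachable c b)).card := by
  -- strong induction on the number of labels
  suffices aux : ∀ (n : ℕ) (β : Type w) [Fintype β] [DecidableEq β], Fintype.card β = n →
      ∀ ends : β → Sym2 V,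
      (univ.filter fun z : β → Bool =>
        ¬ (openGraph (labelledOpen ends z)).Reachable s b ∧
        ((openGraph (labelledOpen ends fun a => !z a)).Reachable c s ∨
          (openGraph (labelledOpen ends fun a => !z a)).Reachable c b)).card ≤
      2 * (univ.filter fun z : β → Bool =>
        ¬ (openGraph (labelledOpen ends z)).Reachable s b ∧
        ((openGraph (labelledOpen ends z)).Reachable c s ∨
          (openGraph (labelledOpen ends z)).Reachable c b)).card by
    exact aux _ α rfl ends
  intro n
  induction n using Nat.strong_induction_on with
  | _ n ih =>
    intro β _ _ hcard ends
    by_cases h1 : ∃ a₀ : β, ∃ t : V, (t = s ∨ t = b) ∧ ends a₀ = s(c, t)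
    · obtain ⟨a₀, t, ht, h₀⟩ := h1
      have hct : c ≠ t := by
        rcases ht with rfl | rfl
        · exact hcs
        · exact hcb
      exact threePoint_cpi_two_of_port_adj ends s b c t ht a₀ h₀ hct
    by_cases h2 : ∃ a₀ : β, ∃ v : V, ends a₀ = s(c, v) ∧ v ≠ s ∧ v ≠ b ∧ v ≠ c
    · obtain ⟨a₀, v, h₀, hvs, hvb, hvc⟩ := h2
      have hm := hmono ends s b c v a₀ h₀ hvs hvb hvc
      have hpos : 0 < Fintype.card β := Fintype.card_pos_iff.mpr ⟨a₀⟩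
      have hcard' : Fintype.card {a // a ≠ a₀} < n := by
        rw [← hcard]
        simp only [ne_eq, Fintype.card_subtype_compl, Fintype.card_subtype_eq]
        omega
      have ih' := ih _ hcard' {a // a ≠ a₀} rfl
        (fun a : {a // a ≠ a₀} => (ends a.1).map fun x => if x = v then c else x)
      omega
    · -- every label at `c` is a loop: `c` reaches nothing, so `L = 0`
      have hloop : ∀ a, c ∈ ends a → (ends a).IsDiag := by
        intro a hca
        have hae : ends a = s(c, Sym2.Mem.other hca) := (Sym2.other_spec hca).symm
        by_contra hnd
        have hyc : Sym2.Mem.other hca ≠ c := by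
          intro h
          apply hnd
          rw [hae, Sym2.mk_isDiag_iff]
          exact h.symm
        by_cases hys : Sym2.Mem.other hca = s
        · exact h1 ⟨a, s, Or.inl rfl, hys ▸ hae⟩
        by_cases hyb : Sym2.Mem.other hca = b
        · exact h1 ⟨a, b, Or.inr rfl, hyb ▸ hae⟩
        · exact h2 ⟨a, Sym2.Mem.other hca, hae, hys, hyb, hyc⟩
      have hL : (univ.filter fun z : β → Bool =>
          ¬ (openGraph (labelledOpen ends z)).Reachable s b ∧
          ((openGraph (labelledOpen ends fun a => !z a)).Reachable c s ∨
            (openGraph (labelledOpen ends fun a => !z a)).Reachable c b)).card = 0 := by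
        refine card_eq_zero.mpr (filter_eq_empty_iff.mpr fun z _ h => ?_)
        rcases h.2 with h' | h'
        · exact hcs (eq_of_reachable_of_loops ends c hloop _ h').symm
        · exact hcb (eq_of_reachable_of_loops ends c hloop _ h').symm
      omega

open Classical in
/-- **3-point CPI₂ from deletion monotonicity.**  Assume that for every finite multigraph on `V`,
every choice of terminals `s, b`, port `c` and every label `a₀` joining `c` to a vertex
`v ∉ {s, b, c}`, deleting `a₀` does not increase `N = 2M − L`
(hypothesis `hmono`, written as `2·M(G−a₀) + L(G) ≤ 2·M(G) + L(G−a₀)`; memo gen 24b, conjecture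
dMONO₃).  Then `L ≤ 2M` for every finite multigraph on `V` with `c ∉ {s, b}`: delete internal port
labels one by one; terminal port labels are handled by `threePoint_cpi_two_of_port_adj`, and a port
carrying only loops has `L = 0`. [facecert gen 24b §0(1)] -/
theorem threePoint_cpi_two_of_deletion_monotone
    (hmono : ∀ {α : Type w} [Fintype α] [DecidableEq α] (ends : α → Sym2 V) (s b c v : V)
      (a₀ : α), ends a₀ = s(c, v) → v ≠ s → v ≠ b → v ≠ c →
      2 * (univ.filter fun z : {a // a ≠ a₀} → Bool =>
          ¬ (openGraph (labelledOpen (fun a : {a // a ≠ a₀} => ends a.1) z)).Reachable s b ∧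
          ((openGraph (labelledOpen (fun a : {a // a ≠ a₀} => ends a.1) z)).Reachable c s ∨
            (openGraph (labelledOpen (fun a : {a // a ≠ a₀} => ends a.1) z)).Reachable c b)).card +
        (univ.filter fun z : α → Bool =>
          ¬ (openGraph (labelledOpen ends z)).Reachable s b ∧
          ((openGraph (labelledOpen ends fun a => !z a)).Reachable c s ∨
            (openGraph (labelledOpen ends fun a => !z a)).Reachable c b)).card ≤
      2 * (univ.filter fun z : α → Bool =>
          ¬ (openGraph (labelledOpen ends z)).Reachable s b ∧
          ((openGraph (labelledOpen ends z)).Reachable c s ∨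
            (openGraph (labelledOpen ends z)).Reachable c b)).card +
        (univ.filter fun z : {a // a ≠ a₀} → Bool =>
          ¬ (openGraph (labelledOpen (fun a : {a // a ≠ a₀} => ends a.1) z)).Reachable s b ∧
          ((openGraph (labelledOpen (fun a : {a // a ≠ a₀} => ends a.1) fun a => !z a)).Reachable c s ∨
            (openGraph (labelledOpen (fun a : {a // a ≠ a₀} => ends a.1)
              fun a => !z a)).Reachable c b)).card)
    {α : Type w} [Fintype α] [DecidableEq α] (ends : α → Sym2 V) (s b c : V)
    (hcs : c ≠ s) (hcb : c ≠ b) :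
    (univ.filter fun z : α → Bool =>
        ¬ (openGraph (labelledOpen ends z)).Reachable s b ∧
        ((openGraph (labelledOpen ends fun a => !z a)).Reachable c s ∨
          (openGraph (labelledOpen ends fun a => !z a)).Reachable c b)).card ≤
      2 * (univ.filter fun z : α → Bool =>
        ¬ (openGraph (labelledOpen ends z)).Reachable s b ∧
        ((openGraph (labelledOpen ends z)).Reachable c s ∨
          (openGraph (labelledOpen ends z)).Reachable c b)).card := by
  -- strong induction on the number of labels
  suffices aux : ∀ (n : ℕ) (β : Type w) [Fintype β] [DecidableEq β], Fintype.card β = n →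
      ∀ ends : β → Sym2 V,
      (univ.filter fun z : β → Bool =>
        ¬ (openGraph (labelledOpen ends z)).Reachable s b ∧
        ((openGraph (labelledOpen ends fun a => !z a)).Reachable c s ∨
          (openGraph (labelledOpen ends fun a => !z a)).Reachable c b)).card ≤
      2 * (univ.filter fun z : β → Bool =>
        ¬ (openGraph (labelledOpen ends z)).Reachable s b ∧
        ((openGraph (labelledOpen ends z)).Reachable c s ∨
          (openGraph (labelledOpen ends z)).Reachable c b)).card by
    exact aux _ α rfl ends
  intro n
  induction n using Nat.strong_induction_on with
  | _ n ih =>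
    intro β _ _ hcard ends
    by_cases h1 : ∃ a₀ : β, ∃ t : V, (t = s ∨ t = b) ∧ ends a₀ = s(c, t)
    · obtain ⟨a₀, t, ht, h₀⟩ := h1
      have hct : c ≠ t := by
        rcases ht with rfl | rfl
        · exact hcs
        · exact hcb
      exact threePoint_cpi_two_of_port_adj ends s b c t ht a₀ h₀ hct
    by_cases h2 : ∃ a₀ : β, ∃ v : V, ends a₀ = s(c, v) ∧ v ≠ s ∧ v ≠ b ∧ v ≠ c
    · obtain ⟨a₀, v, h₀, hvs, hvb, hvc⟩ := h2
      have hm := hmono ends s b c v a₀ h₀ hvs hvb hvc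
      have hpos : 0 < Fintype.card β := Fintype.card_pos_iff.mpr ⟨a₀⟩
      have hcard' : Fintype.card {a // a ≠ a₀} < n := by
        rw [← hcard]
        simp only [ne_eq, Fintype.card_subtype_compl, Fintype.card_subtype_eq]
        omega
      have ih' := ih _ hcard' {a // a ≠ a₀} rfl (fun a : {a // a ≠ a₀} => ends a.1)
      omega
    · -- every label at `c` is a loop: `c` reaches nothing, so `L = 0`
      have hloop : ∀ a, c ∈ ends a → (ends a).IsDiag := by
        intro a hca
        have hae : ends a = s(c, Sym2.Mem.other hca) := (Sym2.other_spec hca).symm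
        by_contra hnd
        have hyc : Sym2.Mem.other hca ≠ c := by
          intro h
          apply hnd
          rw [hae, Sym2.mk_isDiag_iff]
          exact h.symm
        by_cases hys : Sym2.Mem.other hca = s
        · exact h1 ⟨a, s, Or.inl rfl, hys ▸ hae⟩
        by_cases hyb : Sym2.Mem.other hca = b
        · exact h1 ⟨a, b, Or.inr rfl, hyb ▸ hae⟩
        · exact h2 ⟨a, Sym2.Mem.other hca, hae, hys, hyb, hyc⟩
      have hL : (univ.filter fun z : β → Bool =>
          ¬ (openGraph (labelledOpen ends z)).Reachable s b ∧
          ((openGraph (labelledOpen ends fun a => !z a)).Reachable c s ∨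
            (openGraph (labelledOpen ends fun a => !z a)).Reachable c b)).card = 0 := by
        refine card_eq_zero.mpr (filter_eq_empty_iff.mpr fun z _ h => ?_)
        rcases h.2 with h' | h'
        · exact hcs (eq_of_reachable_of_loops ends c hloop _ h').symm
        · exact hcb (eq_of_reachable_of_loops ends c hloop _ h').symm
      omega

end Summit.CriticalPhenomena.PercolationContinuityZ3.Theorems.ThreePointCPIContraction
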